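import Summits.NavierStokesRegularity.NavierStokesRegularity.Theorems.ScenarioCensusRowF1SpacetimeLocus
import HarnessLib

/-!
# LINE 32 «spacetime-locus» port, part 2/4: §8 (cont.) tools (volume under the time zoom BY NAME, reverse Fatou «frequently», the spatial step «frequently»), THE TRANSFER IN
# SPACE–TIME (thick near-locus ⇒ non-null set of slices with non-null exact locus), the engine (`thickRow_of_kills`, `thickFloor_of_kills`, `thickSlack_iff_rowF1`)

Re-homed for the scenario census (typer seat ns-census-typer-1 g9; the thick cells F1βT / F1ωT / F1∣u∣T, the dense cell F1∣u∣d and the floors GTB / GVB / GFB / RFB are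
MEMBERS OF RECORD «DECIDED IN KERNEL IN FILES» of row F1 since census v1.95 (critic idea-crit-3 g8 PASS 07:50:52Z — no price; ref ns-census-ref g12 PRE-CHECK ✓ §17.9 item
63; lead-presearch label item 63); this port makes them TREE-decided): VERBATIM PORT of the NEW sections (§8–§10) of ns-idea-3 LINE 32 «spacetime-locus»,
`pub/ideators/ns-idea-3/lines/spacetime-locus/line-spacetime-locus.lean` sha16 a2ef5b2867fe7a2c (2078 l., lean check rc 0, 0 sorry; its §1–§7 = LINES 27–31 VERBATIM,
taken BY NAME from the landed liouville-socket / sharp-top / thin-top / event-socket / dense-locus ports), split for the 400-line rule into `ScenarioCensusRowF1SpacetimeLocus`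
(§8 vocabulary) → `…SpacetimeLocusTransfer` (§8 transfer + engine) → `…SpacetimeLocusKill` (§9) → `…SpacetimeLocusRows` (§10 + census KEYS).  Lean text VERBATIM in
namespace `…Theorems.ScenarioCensus.SpacetimeLocus` (the line's `…Cruxes.ScenarioCensusRowF1.SpacetimeLocusLine` re-homed) with the five predecessor namespaces opened; port
edits: the bracket lines `section Thick` / `end Thick` dropped and its `variable {F : Type*} [NormedAddCommGroup F]` repeated at the head of the two §8 parts, §8's VERBATIM
restatement of LINE 29's `volume_preimage_zoomTime` not re-declared (BY NAME), `@[conjecture]` on the residuals `BelThickSlack` / `CalmThickSlack` / `SlowThickSlack`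
(≡ `ScenarioCensus.Row_F1`, OPEN), one-line docstrings added where missing (gate lint).  Statements untouched.

No census VALUE is moved here (row F1 stays OPEN-WITH-LINE; the members become TREE-decided by name); NS regularity is NOT proved; `Row_F1` is untouched (zero
movement, `belThickSlack_iff_rowF1` / `calmThickSlack_iff_rowF1` / `slowThickSlack_iff_rowF1`); no summit statement is proved by this file. Lemmas that restate already-landed tree declarations are taken BY NAME (gate lint `dedup.landed`): `fderiv_smul_stPull_apply` = `InviscidTop.fderiv_smul_stPull_apply`, `fderiv_smul_stPull` = `InviscidTop.fderiv_smul_stPull`, `fderiv_fderiv_smul_stPull` = `InviscidTop.fderiv_fderiv_smul_stPull`, `tendsto_clm_of_tendsto_apply` = `InviscidTop.tendsto_clm_of_tendsto_apply`, `tendsto_fderiv_fderiv_apply_of_bound` = `InviscidTop.tendsto_fderiv_fderiv_apply_of_bound`, `tendsto_fderiv_fderiv_of_bound` = `InviscidTop.tendsto_fderiv_fderiv_of_bound`, `tendsto_fderiv_fderiv_of_typeI_seq_Ioo` = `InviscidTop.tendsto_fderiv_fderiv_of_typeI_seq_Ioo`, `fderiv3_smul_stPull` = `FrozenTop.fderiv3_smul_stPull`,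 `tendsto_fderiv3_of_typeI_seq_Ioo` = `FrozenTop.tendsto_fderiv3_of_typeI_seq_Ioo`, `tendsto_physicalTime` = `ColumnarTop.tendsto_physicalTime`, `eventually_fast` = `ColumnarTop.eventually_fast`, `sqrt_timeLag` = `StretchedTop.sqrt_timeLag`, `forall_of_forall_ne_zero` = `StretchedTop.forall_of_forall_ne_zero`, `radius_eq` = `FrozenTop.radius_eq`, `jointCond_everywhere₆` = `FrozenTop.jointCond_everywhere₄`, `continuousOn_quad` = `IntegratedStretch.continuousOn_quad`, `sqrt_nu_timeLag` = `IntegratedStretch.sqrt_nu_timeLag`, `sing_of_not_bounded` = `InviscidTop.sing_of_not_bounded`, `exists_singularZoom_package₃` = `FrozenTop.exists_singularZoom_package₃`, `lapD_eq_zero_of_eq_zero` = `FrozenTop.lapD_eq_zero_of_eq_zero`, `measurableSet_top` = `IntegratedStretch.measurableSet_top`.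
-/

-- the summit and its single problem share the name `NavierStokesRegularity` (D-0017 nested layout)
set_option linter.dupNamespace false

noncomputable section

open MeasureTheory Set Function Filter TopologicalSpace Metric
open scoped Topology NNReal ENNReal InnerProductSpace RealInnerProductSpace Laplacian

namespace Summit.NavierStokesRegularity.NavierStokesRegularity.Theorems.ScenarioCensus.SpacetimeLocus

open Literature.Analysis Literature.Analysis.FluidPDE
open Summit.NavierStokesRegularity.NavierStokesRegularity.Theorems
open Summit.NavierStokesRegularity.NavierStokesRegularity.Theorems.ScenarioCensus.LiouvilleSocket
open Summit.NavierStokesRegularity.NavierStokesRegularity.Theorems.ScenarioCensus.SharpTop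
open Summit.NavierStokesRegularity.NavierStokesRegularity.Theorems.ScenarioCensus.ThinTop
open Summit.NavierStokesRegularity.NavierStokesRegularity.Theorems.ScenarioCensus.EventSocket
open Summit.NavierStokesRegularity.NavierStokesRegularity.Theorems.ScenarioCensus.DenseLocus

variable {F : Type*} [NormedAddCommGroup F]

/-! ### Tools: volume under the time zoom, reverse Fatou «frequently», the spatial step «frequently» -/

/-- **Reverse Fatou for sets, «frequently» version**: if null-measurable `A j ⊆ B`, `μ B < ∞`, have measure `≥ a`
for INFINITELY MANY `j`, the limsup set still has measure `≥ a`. -/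
theorem le_measure_limsupSet_of_frequently {α : Type*} [MeasurableSpace α] {μ : Measure α} {A : ℕ → Set α}
    {B : Set α} (hA : ∀ j, NullMeasurableSet (A j) μ) (hAB : ∀ j, A j ⊆ B) (hB : μ B ≠ ⊤) {a : ℝ≥0∞}
    (h : ∃ᶠ j in atTop, a ≤ μ (A j)) : a ≤ μ (⋂ n : ℕ, ⋃ j ≥ n, A j) := by
  have hDm : ∀ n : ℕ, NullMeasurableSet (⋃ j ≥ n, A j) μ :=
    fun n => NullMeasurableSet.iUnion fun j => NullMeasurableSet.iUnion fun _ => hA j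
  have hanti : Antitone fun n : ℕ => ⋃ j ≥ n, A j := by
    intro m n hmn
    exact iUnion₂_subset fun j hj => subset_iUnion₂ (s := fun j (_ : j ≥ m) => A j) j (hmn.trans hj)
  have hfin : ∃ n : ℕ, μ (⋃ j ≥ n, A j) ≠ ⊤ :=
    ⟨0, ne_top_of_le_ne_top hB (measure_mono (iUnion₂_subset fun j _ => hAB j))⟩
  refine ge_of_tendsto (tendsto_measure_iInter_atTop hDm hanti hfin) (Eventually.of_forall fun n => ?_)
  obtain ⟨j, hj, hjn⟩ := (h.and_eventually (eventually_ge_atTop n)).exists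
  exact hj.trans (measure_mono (subset_iUnion₂ (s := fun j (_ : j ≥ n) => A j) j hjn))

/-- **The spatial step at ONE similarity time** (LINE 31's transfer, «frequently» version): density at the blow-up
centre at the zoom times `t_j(s)` for infinitely many `j` (each `ε = 1/(k+1)`) already forces a non-null exact locus
on the slice `s` of the limit. -/
theorem volume_zoomNear_ge_of_denseAt {q : Jet → F} {ε δ ρ T ν : ℝ} {u : ℝ → E3 → E3} {x₀ : E3} {α β R : ℝ}
    {c : ℕ → ℝ} (hν : 0 < ν) (hα : 0 < α) (hβ : 0 < β) (hR : 0 < R) (hαR : α * R = β)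
    (hαν : α * Real.sqrt ν = Real.sqrt β) (hcpos : ∀ j, 0 < c j) (j : ℕ) {s : ℝ}
    (hj0 : 0 ≤ T + c j ^ 2 * β * s) (hd : DenseAt q ε δ ρ T ν u (T + c j ^ 2 * β * s) x₀) :
    ENNReal.ofReal δ * volume (ball (0 : E3) (ρ * Real.sqrt (-s))) ≤
      volume (zoomNear q ε T ν u x₀ β R c s (ρ * Real.sqrt (-s)) j) := by
  have hl : 0 < c j * R := mul_pos (hcpos j) hR
  have hrad : ρ * Real.sqrt (ν * (T - (T + c j ^ 2 * β * s))) = (c j * R) * (ρ * Real.sqrt (-s)) := by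
    rw [IntegratedStretch.sqrt_nu_timeLag hν hα hβ hαR hαν hcpos j]; ring
  have hball : (fun y : E3 => x₀ + (c j * R) • y) ⁻¹' ball x₀ (ρ * Real.sqrt (ν * (T - (T + c j ^ 2 * β * s)))) =
      ball 0 (ρ * Real.sqrt (-s)) := by
    rw [hrad]; exact preimage_zoom_ball x₀ hl _
  have hvol : ∀ E : Set E3, volume ((fun y : E3 => x₀ + (c j * R) • y) ⁻¹' E) =
      ENNReal.ofReal (((c j * R) ^ 3)⁻¹) * volume E := fun E => volume_preimage_zoomSpace hl x₀ E
  have e1 : zoomNear q ε T ν u x₀ β R c s (ρ * Real.sqrt (-s)) j = (fun y : E3 => x₀ + (c j * R) • y) ⁻¹'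
      (eventSlice (NearEv q ε) T ν u (T + c j ^ 2 * β * s) ∩
        ball x₀ (ρ * Real.sqrt (ν * (T - (T + c j ^ 2 * β * s))))) := by
    rw [preimage_inter, hball, inter_comm]
    ext y
    simp only [zoomNear, mem_setOf_eq, hj0, true_and, mem_inter_iff, mem_preimage]
  unfold DenseAt at hd
  rw [e1, hvol, ← hball, hvol, mul_left_comm]
  exact mul_le_mul' le_rfl hd

/-- A slice whose exact locus is frequently charged has non-null exact locus. -/
theorem sliceLocus_ne_zero_of_frequently {q : Jet → F} (hq : Continuous q) {T ν : ℝ} {u : ℝ → E3 → E3}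
    {p : ℝ → E3 → ℝ} {x₀ : E3} {α β R : ℝ} {c : ℕ → ℝ} {W : ℝ → E3 → E3}
    (hν : 0 < ν) (hsol : IsClassicalNSSolutionOn (Ico 0 T) ν 0 u p)
    (hα : 0 < α) (hβ : 0 < β) (hαR : α * R = β) (hαν : α * Real.sqrt ν = Real.sqrt β)
    (hcpos : ∀ j, 0 < c j)
    (hpt : ∀ t < 0, ∀ y : E3,
      Tendsto (fun j => (c j * α) • u (T + c j ^ 2 * β * t) (x₀ + (c j * R) • y)) atTop (𝓝 (W t y)))
    (hgrad : ∀ t < 0, ∀ y : E3,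
      Tendsto (fun j => (c j * α * (c j * R)) • fderiv ℝ (u (T + c j ^ 2 * β * t)) (x₀ + (c j * R) • y)) atTop
        (𝓝 (fderiv ℝ (W t) y)))
    {δ ρ s : ℝ} (hδ : 0 < δ) (hρ : 0 < ρ) (hs : s < 0)
    (h : ∀ k : ℕ, ∃ᶠ j in atTop, ENNReal.ofReal δ * volume (ball (0 : E3) (ρ * Real.sqrt (-s))) ≤
      volume (zoomNear q (1 / ((k : ℝ) + 1)) T ν u x₀ β R c s (ρ * Real.sqrt (-s)) j)) :
    volume {y : E3 | q (ancientJet W s y) = 0} ≠ 0 := by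
  have hs' : 0 < -s := neg_pos.2 hs
  have hrpos : 0 < ρ * Real.sqrt (-s) := mul_pos hρ (Real.sqrt_pos.2 hs')
  have hmeas : ∀ ε j, MeasurableSet (zoomNear q ε T ν u x₀ β R c s (ρ * Real.sqrt (-s)) j) :=
    fun ε j => measurableSet_zoomNear hq ε hsol x₀ hβ R hcpos hs _ j
  have hballfin : volume (ball (0 : E3) (ρ * Real.sqrt (-s))) ≠ ⊤ := measure_ball_lt_top.ne
  have step2 : ∀ k : ℕ, ENNReal.ofReal δ * volume (ball (0 : E3) (ρ * Real.sqrt (-s))) ≤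
      volume (⋂ n : ℕ, ⋃ j ≥ n, zoomNear q (1 / ((k : ℝ) + 1)) T ν u x₀ β R c s (ρ * Real.sqrt (-s)) j) :=
    fun k => le_measure_limsupSet_of_frequently (fun j => (hmeas _ j).nullMeasurableSet)
      (fun j => zoomNear_subset_ball q _ T ν u x₀ β R c s _ j) hballfin (h k)
  have hSmeas : ∀ k : ℕ, NullMeasurableSet
      (⋂ n : ℕ, ⋃ j ≥ n, zoomNear q (1 / ((k : ℝ) + 1)) T ν u x₀ β R c s (ρ * Real.sqrt (-s)) j) volume :=
    fun k => (MeasurableSet.iInter fun n => MeasurableSet.iUnion fun j =>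
      MeasurableSet.iUnion fun _ => hmeas _ j).nullMeasurableSet
  have hSanti : Antitone fun k : ℕ =>
      ⋂ n : ℕ, ⋃ j ≥ n, zoomNear q (1 / ((k : ℝ) + 1)) T ν u x₀ β R c s (ρ * Real.sqrt (-s)) j := by
    intro k l hkl
    have hkl' : (k : ℝ) ≤ l := by exact_mod_cast hkl
    have hε : 1 / ((l : ℝ) + 1) ≤ 1 / ((k : ℝ) + 1) := one_div_le_one_div_of_le (by positivity) (by linarith)
    exact iInter_mono fun n => iUnion₂_mono fun j _ => zoomNear_mono q hε T ν u x₀ β R c s _ j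
  have hSfin : ∃ k : ℕ, volume
      (⋂ n : ℕ, ⋃ j ≥ n, zoomNear q (1 / ((k : ℝ) + 1)) T ν u x₀ β R c s (ρ * Real.sqrt (-s)) j) ≠ ⊤ :=
    ⟨0, ne_top_of_le_ne_top hballfin (measure_mono (iInter_subset_of_subset 0
      (iUnion₂_subset fun j _ => zoomNear_subset_ball q _ T ν u x₀ β R c s _ j)))⟩
  have hZ : ENNReal.ofReal δ * volume (ball (0 : E3) (ρ * Real.sqrt (-s))) ≤
      volume (⋂ k : ℕ, ⋂ n : ℕ, ⋃ j ≥ n, zoomNear q (1 / ((k : ℝ) + 1)) T ν u x₀ β R c s (ρ * Real.sqrt (-s)) j) :=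
    ge_of_tendsto (tendsto_measure_iInter_atTop hSmeas hSanti hSfin) (Eventually.of_forall step2)
  have hsub : (⋂ k : ℕ, ⋂ n : ℕ, ⋃ j ≥ n, zoomNear q (1 / ((k : ℝ) + 1)) T ν u x₀ β R c s (ρ * Real.sqrt (-s)) j)
      ⊆ {y : E3 | q (ancientJet W s y) = 0} := by
    intro y hy
    rw [mem_setOf_eq]
    by_contra hne
    have hd : 0 < ‖q (ancientJet W s y)‖ := norm_pos_iff.2 hne
    obtain ⟨k, hk⟩ := exists_nat_one_div_lt (half_pos hd)
    have hlim : Tendsto (fun j => ‖q (physJet T ν u (T + c j ^ 2 * β * s) (x₀ + (c j * R) • y))‖) atTop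
        (𝓝 ‖q (ancientJet W s y)‖) :=
      ((continuous_norm.comp hq).tendsto _).comp (tendsto_physJet_zoom hν hα hβ hαR hαν hcpos hpt hgrad hs y)
    have hev : ∀ᶠ j in atTop, ‖q (ancientJet W s y)‖ / 2 <
        ‖q (physJet T ν u (T + c j ^ 2 * β * s) (x₀ + (c j * R) • y))‖ :=
      (tendsto_order.1 hlim).1 _ (by linarith)
    have hfreq : ∃ᶠ j in atTop,
        y ∈ zoomNear q (1 / ((k : ℝ) + 1)) T ν u x₀ β R c s (ρ * Real.sqrt (-s)) j :=
      (mem_limsupSet_iff _ y).1 (mem_iInter.1 hy k)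
    obtain ⟨j, hjmem, hjev⟩ := (hfreq.and_eventually hev).exists
    have hlt : ‖q (physJet T ν u (T + c j ^ 2 * β * s) (x₀ + (c j * R) • y))‖ < 1 / ((k : ℝ) + 1) := hjmem.2.2
    linarith
  have hpos : 0 < ENNReal.ofReal δ * volume (ball (0 : E3) (ρ * Real.sqrt (-s))) :=
    ENNReal.mul_pos (ENNReal.ofReal_pos.2 hδ).ne' (measure_ball_pos volume (0 : E3) hrpos).ne'
  exact (hpos.trans_le (hZ.trans (measure_mono hsub))).ne'

/-! ### THE TRANSFER IN SPACE–TIME: thick near-locus ⇒ non-null set of slices with non-null exact locus -/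

/-- The pulled-back good-time set at window scale `l`, accuracy `1/(k+1)`, inside the similarity window `[−b, −a]`. -/
def pullGood (q : Jet → F) (k : ℕ) (δ ρ T ν : ℝ) (u : ℝ → E3 → E3) (a b l : ℝ) : Set ℝ :=
  Icc (-b) (-a) ∩ (fun s : ℝ => T + l * s) ⁻¹' goodTimes q (1 / ((k : ℝ) + 1)) δ ρ T ν u

/-- The pulled-back good times lie in the window. -/
theorem pullGood_subset (q : Jet → F) (k : ℕ) (δ ρ T ν : ℝ) (u : ℝ → E3 → E3) (a b l : ℝ) :
    pullGood q k δ ρ T ν u a b l ⊆ Icc (-b) (-a) := inter_subset_left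

/-- The pulled-back good times are antitone. -/
theorem pullGood_anti (q : Jet → F) {k m : ℕ} (hkm : k ≤ m) (δ ρ T ν : ℝ) (u : ℝ → E3 → E3) (a b l : ℝ) :
    pullGood q m δ ρ T ν u a b l ⊆ pullGood q k δ ρ T ν u a b l := by
  have hkm' : (k : ℝ) ≤ m := by exact_mod_cast hkm
  have hε : 1 / ((m : ℝ) + 1) ≤ 1 / ((k : ℝ) + 1) := one_div_le_one_div_of_le (by positivity) (by linarith)
  exact inter_subset_inter_right _ (preimage_mono (goodTimes_mono q hε δ ρ T ν u))

/-- The window chart identifies `goodTimes ∩ [T − l b, T − l a]` with the pulled-back set (`l > 0`). -/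
theorem preimage_goodTimes_window (q : Jet → F) (k : ℕ) (δ ρ T ν : ℝ) (u : ℝ → E3 → E3) (a b : ℝ) {l : ℝ}
    (hl : 0 < l) :
    (fun s : ℝ => T + l * s) ⁻¹' (goodTimes q (1 / ((k : ℝ) + 1)) δ ρ T ν u ∩ Icc (T - l * b) (T - l * a)) =
      pullGood q k δ ρ T ν u a b l := by
  ext s
  simp only [pullGood, mem_preimage, mem_inter_iff, mem_Icc]
  constructor
  · rintro ⟨hG, h1, h2⟩
    exact ⟨⟨by nlinarith, by nlinarith⟩, hG⟩
  · rintro ⟨⟨h1, h2⟩, hG⟩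
    exact ⟨hG, by nlinarith, by nlinarith⟩

/-- **Space–time transfer theorem (the heart of this line).**  Along a singular Type-I zoom at `x₀`, a SCALE-THICK
near-locus of a continuous defect `q` forces the set of similarity times `s < 0` whose slice carries a NON-NULL exact
locus `{y : q(ancientJet W s y) = 0}` to be itself NON-NULL (indeed of measure `≥ η`).  Proof: at the zoom scales
`l_j = c_j² β → 0⁺` the good times fill measure `≥ η l_j` of the window; pulled back by the window chart this is a set
of similarity times of measure `≥ η` (`volume_preimage_zoomTime`); reverse Fatou in TIME gives measure `≥ η` to the
similarity times that are good for infinitely many `j`; the diagonal over `ε = 1/(k+1)` keeps measure `≥ η`; and at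
such a similarity time the spatial step of LINE 31 («frequently» version) yields a non-null exact slice locus. -/
theorem thickLocus_of_thickNear {q : Jet → F} (hq : Continuous q) {T ν : ℝ} {u : ℝ → E3 → E3} {p : ℝ → E3 → ℝ}
    {x₀ : E3} {α β R : ℝ} {c : ℕ → ℝ} {W : ℝ → E3 → E3}
    (hν : 0 < ν) (hsol : IsClassicalNSSolutionOn (Ico 0 T) ν 0 u p)
    (hα : 0 < α) (hβ : 0 < β) (hR : 0 < R) (hαR : α * R = β) (hαν : α * Real.sqrt ν = Real.sqrt β)
    (hcpos : ∀ j, 0 < c j) (hclim : Tendsto c atTop (𝓝 0))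
    (hpt : ∀ t < 0, ∀ y : E3,
      Tendsto (fun j => (c j * α) • u (T + c j ^ 2 * β * t) (x₀ + (c j * R) • y)) atTop (𝓝 (W t y)))
    (hgrad : ∀ t < 0, ∀ y : E3,
      Tendsto (fun j => (c j * α * (c j * R)) • fderiv ℝ (u (T + c j ^ 2 * β * t)) (x₀ + (c j * R) • y)) atTop
        (𝓝 (fderiv ℝ (W t) y)))
    (hTh : ThickNear q T ν u) :
    volume {s : ℝ | s < 0 ∧ volume {y : E3 | q (ancientJet W s y) = 0} ≠ 0} ≠ 0 := by
  obtain ⟨δ, hδ, ρ, hρ, a, b, η, ha, hab, hη, hth⟩ := hTh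
  have hl : ∀ j, 0 < c j ^ 2 * β := fun j => mul_pos (pow_pos (hcpos j) 2) hβ
  have hl0 : Tendsto (fun j => c j ^ 2 * β) atTop (𝓝[>] (0 : ℝ)) := by
    refine tendsto_nhdsWithin_iff.2 ⟨?_, Eventually.of_forall fun j => hl j⟩
    have h := (hclim.pow 2).mul_const β
    rw [zero_pow two_ne_zero, zero_mul] at h
    exact h
  have hAmeas : ∀ k j, MeasurableSet (pullGood q k δ ρ T ν u a b (c j ^ 2 * β)) := fun k j =>
    measurableSet_Icc.inter ((measurableSet_goodTimes hq _ δ ρ hsol).preimage (by fun_prop))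
  have hIfin : volume (Icc (-b) (-a)) ≠ ⊤ := measure_Icc_lt_top.ne
  -- Step 1: at the zoom scales the pulled-back good times have measure ≥ η, eventually in j
  have step1 : ∀ k : ℕ, ∀ᶠ j in atTop, ENNReal.ofReal η ≤ volume (pullGood q k δ ρ T ν u a b (c j ^ 2 * β)) := by
    intro k
    have hev := hl0.eventually (hth (1 / ((k : ℝ) + 1)) (by positivity))
    filter_upwards [hev] with j hj
    calc ENNReal.ofReal η
        = ENNReal.ofReal (c j ^ 2 * β)⁻¹ * ENNReal.ofReal (η * (c j ^ 2 * β)) := by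
          rw [← ENNReal.ofReal_mul (inv_nonneg.2 (hl j).le)]
          congr 1
          have hc0 : c j ≠ 0 := (hcpos j).ne'
          field_simp
      _ ≤ ENNReal.ofReal (c j ^ 2 * β)⁻¹ *
            volume (goodTimes q (1 / ((k : ℝ) + 1)) δ ρ T ν u ∩ Icc (T - c j ^ 2 * β * b) (T - c j ^ 2 * β * a)) :=
          mul_le_mul' le_rfl hj
      _ = volume (pullGood q k δ ρ T ν u a b (c j ^ 2 * β)) := by
          rw [← volume_preimage_zoomTime (hl j) T, preimage_goodTimes_window q k δ ρ T ν u a b (hl j)]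
  -- Step 2: reverse Fatou in time, then the diagonal over k
  have step2 : ∀ k : ℕ, ENNReal.ofReal η ≤ volume (⋂ n : ℕ, ⋃ j ≥ n, pullGood q k δ ρ T ν u a b (c j ^ 2 * β)) :=
    fun k => le_measure_limsupSet (fun j => (hAmeas k j).nullMeasurableSet)
      (fun j => pullGood_subset q k δ ρ T ν u a b _) hIfin (step1 k)
  have hSmeas : ∀ k : ℕ, NullMeasurableSet (⋂ n : ℕ, ⋃ j ≥ n, pullGood q k δ ρ T ν u a b (c j ^ 2 * β)) volume :=
    fun k => (MeasurableSet.iInter fun n => MeasurableSet.iUnion fun j =>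
      MeasurableSet.iUnion fun _ => hAmeas k j).nullMeasurableSet
  have hSanti : Antitone fun k : ℕ => ⋂ n : ℕ, ⋃ j ≥ n, pullGood q k δ ρ T ν u a b (c j ^ 2 * β) :=
    fun k m hkm => iInter_mono fun n => iUnion₂_mono fun j _ => pullGood_anti q hkm δ ρ T ν u a b _
  have hSfin : ∃ k : ℕ, volume (⋂ n : ℕ, ⋃ j ≥ n, pullGood q k δ ρ T ν u a b (c j ^ 2 * β)) ≠ ⊤ :=
    ⟨0, ne_top_of_le_ne_top hIfin (measure_mono (iInter_subset_of_subset 0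
      (iUnion₂_subset fun j _ => pullGood_subset q 0 δ ρ T ν u a b _)))⟩
  have hS : ENNReal.ofReal η ≤
      volume (⋂ k : ℕ, ⋂ n : ℕ, ⋃ j ≥ n, pullGood q k δ ρ T ν u a b (c j ^ 2 * β)) :=
    ge_of_tendsto (tendsto_measure_iInter_atTop hSmeas hSanti hSfin) (Eventually.of_forall step2)
  -- Step 3: every similarity time of the diagonal set carries a non-null exact slice locus
  have hsub : (⋂ k : ℕ, ⋂ n : ℕ, ⋃ j ≥ n, pullGood q k δ ρ T ν u a b (c j ^ 2 * β)) ⊆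
      {s : ℝ | s < 0 ∧ volume {y : E3 | q (ancientJet W s y) = 0} ≠ 0} := by
    intro s hs
    have hfreq : ∀ k : ℕ, ∃ᶠ j in atTop, s ∈ pullGood q k δ ρ T ν u a b (c j ^ 2 * β) :=
      fun k => (mem_limsupSet_iff _ s).1 (mem_iInter.1 hs k)
    obtain ⟨j₀, hj₀⟩ := (hfreq 0).exists
    have hsneg : s < 0 := by
      have := (pullGood_subset q 0 δ ρ T ν u a b _ hj₀).2
      linarith
    refine ⟨hsneg, sliceLocus_ne_zero_of_frequently hq hν hsol hα hβ hαR hαν hcpos hpt hgrad hδ hρ hsneg fun k => ?_⟩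
    refine (hfreq k).mono fun j hj => ?_
    have hG : T + c j ^ 2 * β * s ∈ goodTimes q (1 / ((k : ℝ) + 1)) δ ρ T ν u := hj.2
    exact volume_zoomNear_ge_of_denseAt hν hα hβ hR hαR hαν hcpos j hG.1.1.le (hG.2 x₀)
  exact (((ENNReal.ofReal_pos.2 hη).trans_le (hS.trans (measure_mono hsub)))).ne'

/-! ### The engine: rows, floors and the residual from a continuous THICK-killing defect -/

/-- **Engine (row).** -/
theorem thickRow_of_kills {q : Jet → F} (hq : Continuous q) (hK : ThickLocusKills q) : ThickRow q := by
  intro ν T hν hT u p hsol hLH hdec hTI hTh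
  obtain ⟨M, hM⟩ := exists_isTypeIBlowupWith hν hTI
  apply hasSmoothExtensionPast_of_forall_exists_parabolicCylinder hν hT hsol hLH hdec
  intro x₀
  by_contra hno
  obtain ⟨α, β, R, c, W, hα, hβ, hR, hαR, hαν, hcpos, hclim, hW, hpt, hgrad, -, -, t, ht, y, hne⟩ :=
    FrozenTop.exists_singularZoom_package₃ hν hT hsol hLH hdec hM x₀ (InviscidTop.sing_of_not_bounded hno)
  exact hne (hK M W hW (thickLocus_of_thickNear hq hν hsol hα hβ hR hαR hαν hcpos hclim hpt hgrad hTh) t ht y)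

/-- **Engine (floor).** -/
theorem thickFloor_of_kills {q : Jet → F} (hq : Continuous q) (hK : ThickLocusKills q) : ThickFloor q :=
  fun ν T hν hT u p hmax hLH hdec hTI hTh => hmax.2 (thickRow_of_kills hq hK ν T hν hT u p hmax.1 hLH hdec hTI hTh)

/-- **Split**: the thick row and the thick slack give `Row_F1`. -/
theorem rowF1_of_thickRow {q : Jet → F} (hR : ThickRow q) (hS : ThickSlack q) : ScenarioCensus.Row_F1 := by
  unfold ScenarioCensus.Row_F1
  intro ν T hν hT u p hsol hLH hdec hTI
  by_contra hext
  exact hext (hR ν T hν hT u p hsol hLH hdec hTI (hS ν T hν hT u p ⟨hsol, hext⟩ hLH hdec hTI))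

/-- `Row_F1` gives every thick slack vacuously. -/
theorem thickSlack_of_rowF1 (q : Jet → F) (h : ScenarioCensus.Row_F1) : ThickSlack q :=
  fun ν T hν hT u p hmax hLH hdec hTI => absurd (h ν T hν hT u p hmax.1 hLH hdec hTI) hmax.2

/-- **The thick residual of a continuous thick-killing defect is EQUIVALENT to `Row_F1`** (honest label). -/
theorem thickSlack_iff_rowF1 {q : Jet → F} (hq : Continuous q) (hK : ThickLocusKills q) :
    ThickSlack q ↔ ScenarioCensus.Row_F1 :=
  ⟨rowF1_of_thickRow (thickRow_of_kills hq hK), thickSlack_of_rowF1 q⟩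

/-- Thick floor and thick slack together exclude maximal Type-I blow-up data outright. -/
theorem thickFloor_thickSlack_exclude {q : Jet → F} (hF : ThickFloor q) (hS : ThickSlack q) :
    ∀ (ν T : ℝ), 0 < ν → 0 < T → ∀ (u : ℝ → E3 → E3) (p : ℝ → E3 → ℝ),
      IsMaximalSmoothSolution ν 0 u p T → IsLerayHopfOn T ν 0 (u 0) u → HasRapidSpatialDecay (u 0) →
      ¬ IsTypeIBlowup u T :=
  fun ν T hν hT u p hmax hLH hdec hTI => hF ν T hν hT u p hmax hLH hdec hTI (hS ν T hν hT u p hmax hLH hdec hTI)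

end Summit.NavierStokesRegularity.NavierStokesRegularity.Theorems.ScenarioCensus.SpacetimeLocus

end
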